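import Literature.MathematicalPhysics.QuantumLattice.XYOrderThermalGDProofs
import Literature.MathematicalPhysics.QuantumLattice.XYTorusKroneckerForm
import HarnessLib

/-!
# Gaussian domination for the quantum XY model with direction-dependent (reflection-invariant)
# couplings — Kennedy–Lieb–Shastry's model "interpolating between two and three dimensions"

Topic `MathematicalPhysics/QuantumLattice`; companion of `XYOrderGDProofs.lean` (ground state,
uniform coupling) and `XYOrderThermalGDProofs.lean` (positive temperature, uniform coupling).
No named fact is introduced; everything here is a theorem.

## What is printed

Kennedy, Lieb and Shastry, J. Stat. Phys. **53** (1988) 1019–1030, p. 1020: "We also consider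
a spin-1/2 model which interpolates between two and three dimensions. This model is the
three-dimensional cubic lattice with the coupling constant in two of the three lattice
directions taken to be 1, but in the third lattice direction it is taken to be `r` … (Although we
only consider the ground states of these models, the techniques we use may be combined with the
techniques of Dyson et al. for nonzero temperatures …)"; p. 1023, eq. (5):
`H = Σ_{⟨xy⟩} J_{xy} 𝐒_x·𝐒_y`, "where the coupling constant `J_{xy}` equals 1 for bonds `{xy}` in
one of the first two coordinate directions and equals `r` for bonds in the third coordinate
direction", with the infrared bound (6)–(7) in the anisotropic spin-wave energy
`E^r_q = 2 - cos q₁ - cos q₂ + r(1 - cos q₃)`; p. 1026: "For the model (5) … the bound (14) holds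
with `E_{q-Q}` replaced by `E^r_{q-Q}`", i.e. the ground-state **Gaussian domination**
`E(h) ≥ E(0)` of eq. (18) and its proof by reflection positivity in the planes through a bond and
the descent on the number of bonds with `h_x ≠ h_y` (pp. 1027–1029, eqs. (20)–(25)) hold verbatim
for direction-dependent couplings: the reflection through planes perpendicular to direction `j`
preserves the direction of every bond, the two half-space Hamiltonians are mirror images, and the
crossing bonds all carry the same nonnegative coupling. For the XY model (Kennedy–Lieb–Shastry,
PRL **61** (1988) 2582, after eq. (4): "the proof of (4) in [the JSP paper] applies to the XY
model", field on the first spin component) this file carries out that remark.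

## Contents (all `d`, all spins `S = n/2`, even side `L ≥ 4`)

For a weight `w` on the bonds of the torus `(ℤ/Lℤ)^d` which is nonnegative and invariant under all
the reflections through bond planes (`w (θe) = w e`, `θ = Torus.reflectBetweenSites j a`) — the
case of record being the direction-dependent nearest-neighbour couplings
`w {x, x + eᵢ} = Kᵢ ≥ 0` (`dirCoupling K`, Kennedy–Lieb–Shastry's `(1, 1, r)`):

* `xyWeightedHamiltonian L n w = -Σ_{⟨xy⟩} w_{xy}(S¹_xS¹_y + S²_xS²_y)`, the field Hamiltonian
  `xyWeightedFieldHamiltonian L n w h = Σ_{⟨xy⟩} w_{xy}[-S¹_xS¹_y - S²_xS²_y - (h_x - h_y)(S¹_x - S¹_y)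
  + ½(h_x - h_y)²]` ([KLS1988JSP] eq. (17), XY version, weighted) and its rotated real form
  `xyWeightedRealFieldHamiltonian` (bond terms `xyRealBond`);
* `xyWeightedRealFieldHamiltonian_eq_submatrix` — the Kronecker form (21)
  `H♭_w(g) = A ⊗ 1 + 1 ⊗ B - Σᵢ Mᵢ ⊗ Nᵢ` along every pair of planes, with the weight `√w` of the
  crossing bond on `Mᵢ`, `Nᵢ` (the tree's `xyRealBond_cross`, `sum_edgeFinset_split`);
* `exists_unitary_conj_xyFieldBond` — the sublattice rotation as ONE unitary conjugating every
  bond term `{x,y}` of the torus graph into its real form (eqs. (15)–(16)), whence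
  `groundEnergy_xyWeightedFieldHamiltonian_eq`, `partitionFn_xyWeightedFieldHamiltonian_eq`;
* `groundEnergy_reflect_le_weighted` — `½E_w(h^L) + ½E_w(h^R) ≤ E_w(h)`
  (`Matrix.kls_groundEnergy_reflection`); `partitionFn_weighted_sq_le` — `Z_w(h)² ≤ Z_w(h^L)Z_w(h^R)`
  ([DLS1978] Lemma 4.1, `Matrix.trace_exp_kroneckerSum_le`);
* **`xyWeighted_gaussianDomination_ground`** — `E₀(H_w) ≤ E₀(H_w(h))` ([KLS1988JSP] (18)) and
  **`partitionFn_xyWeightedField_le`** — `Z_β(H_w(h)) ≤ Z_β(H_w)` ([DLS1978] Thm. 4.2), by the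
  descent of pp. 1027–1029 with the tree's `badBondCount_reflect`;
* the direction-dependent couplings: `dirCoupling K`, `dirCoupling_mk_add_single` (`= Kᵢ` on
  `{x, x + eᵢ}`), `dirCoupling_map_reflectBetweenSites` (reflection invariance),
  `xyAnisoTorus L n K = -Σ_x Σᵢ Kᵢ (S¹_xS¹_{x+eᵢ} + S²_xS²_{x+eᵢ})` (`xyAnisoTorus_eq_sum`,
  `xyAnisoTorus_one = xyTorus`), and the two Gaussian domination theorems for it,
  `xyAniso_gaussianDomination_ground`, `partitionFn_xyAnisoField_le`.

`TODO(general form)`: the Heisenberg antiferromagnet version of [KLS1988JSP] eq. (5) itself (the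
rotation about the 2-axis, field on `S³`) is the same bookkeeping over `HeisenbergOrderNeelGD.lean`.

## References

* [KLS1988JSP] T. Kennedy, E. H. Lieb, B. S. Shastry, *Existence of Néel order in some spin-1/2
  Heisenberg antiferromagnets*, J. Stat. Phys. 53 (1988) 1019–1030: p. 1020, eqs. (5)–(9)
  (p. 1023), (14)–(25) (pp. 1026–1029) (read in: E. H. Lieb, *Statistical Mechanics (Selecta)*,
  paper IV.7).
* [KLS1988PRL] T. Kennedy, E. H. Lieb, B. S. Shastry, Phys. Rev. Lett. 61 (1988) 2582–2584,
  after eq. (4).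
* [DLS1978] F. J. Dyson, E. H. Lieb, B. Simon, J. Stat. Phys. 18 (1978) 335–383, Lemma 4.1,
  Thm. 4.2.
-/

noncomputable section

open Matrix Finset NormedSpace
open scoped ComplexOrder Kronecker
open Literature.MathematicalPhysics.QuantumLattice Literature.MathematicalPhysics.QuantumLattice.SpinOperators
  Literature.Probability.LatticeModels Literature.Barriers.AtomisticToContinuum.BoseGas

namespace Literature.MathematicalPhysics.QuantumLattice

variable {d : ℕ}

/-! ### The weighted Hamiltonians -/

section Defs

variable {Λ : Type*} [Fintype Λ] [DecidableEq Λ]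

/-- The bond term of the XY field Hamiltonian (before the sublattice rotation):
`-½(S¹_xS¹_y + S¹_yS¹_x) - ½(S²_xS²_y + S²_yS²_x) - (h_x - h_y)(S¹_x - S¹_y) + ½(h_x - h_y)²` — the
summand of `xyFieldHamiltonian_eq_edgeSum` ([KLS1988JSP] eq. (17), XY version). [cite: KLS1988JSP, eq. (17)] -/
def xyFieldBond (n : ℕ) (h : Λ → ℝ) (x y : Λ) : Op Λ (n + 1) :=
  -spinBond n 0 x y - spinBond n 1 x y -
    ((h x - h y : ℝ) : ℂ) • (siteSpin n x 0 - siteSpin n y 0) +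
    (((h x - h y) ^ 2 / 2 : ℝ) : ℂ) • 1

/-- `xyFieldBond` is symmetric in the two sites. [cite: KLS1988JSP, eq. (17)] -/
theorem xyFieldBond_comm (n : ℕ) (h : Λ → ℝ) (x y : Λ) :
    xyFieldBond n h x y = xyFieldBond n h y x := by
  simp only [xyFieldBond, spinBond_comm n _ x y]
  congr 2
  · rw [← neg_sub (h y) (h x), Complex.ofReal_neg, neg_smul, ← smul_neg, neg_sub]
  · rw [← neg_sub (h y) (h x), neg_sq]

/-- At zero field the bond term is `-(S¹_xS¹_y + S²_xS²_y)` (symmetrised) ([KLS1988JSP] after eq. (17):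
"When h = 0 this agrees with the above Hamiltonian"). [cite: KLS1988JSP, eq. (17)] -/
theorem xyFieldBond_zero (n : ℕ) (x y : Λ) :
    xyFieldBond n (fun _ => (0 : ℝ)) x y = -xyBond n x y := by
  simp only [xyFieldBond, xyBond, sub_self, Complex.ofReal_zero, zero_smul, sub_zero]
  norm_num
  abel

/-- If `h_x = h_y` the bond term is the zero-field one. [cite: KLS1988JSP, eq. (17), p. 1027] -/
theorem xyFieldBond_of_eq (n : ℕ) {h : Λ → ℝ} {x y : Λ} (hxy : h x = h y) :
    xyFieldBond n h x y = -xyBond n x y := by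
  simp only [xyFieldBond, xyBond, hxy, sub_self, Complex.ofReal_zero, zero_smul, sub_zero]
  norm_num
  abel

variable (L : ℕ) [NeZero L] (n : ℕ)

/-- **The XY Hamiltonian with bond weights** `H_w = -Σ_{⟨xy⟩} w_{xy}(S¹_xS¹_y + S²_xS²_y)` on the
torus `(ℤ/Lℤ)^d`, spin `n/2` ([KLS1988JSP] eq. (5) `Σ J_{xy} 𝐒_x·𝐒_y`, XY version of
[KLS1988PRL] eq. (1)). [cite: KLS1988JSP, eq. (5)] [cite: KLS1988PRL, eq. (1)] -/
def xyWeightedHamiltonian (w : Sym2 (TorusSite d L) → ℝ) : Op (TorusSite d L) (n + 1) :=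
  ∑ e ∈ (torusGraph d L).edgeFinset,
    ((w e : ℝ) : ℂ) • Sym2.lift ⟨fun x y => -xyBond n x y, fun x y => by
      dsimp only; rw [xyBond_comm]⟩ e

/-- **The weighted field Hamiltonian**
`H_w(h) = Σ_{⟨xy⟩} w_{xy}[-S¹_xS¹_y - S²_xS²_y - (h_x - h_y)(S¹_x - S¹_y) + ½(h_x - h_y)²]`
([KLS1988JSP] eq. (17) with the couplings of eq. (5); XY version, field on the first component).
[cite: KLS1988JSP, eqs. (5), (17)] -/
def xyWeightedFieldHamiltonian (w : Sym2 (TorusSite d L) → ℝ) (h : TorusSite d L → ℝ) :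
    Op (TorusSite d L) (n + 1) :=
  ∑ e ∈ (torusGraph d L).edgeFinset,
    ((w e : ℝ) : ℂ) • Sym2.lift ⟨fun x y => xyFieldBond n h x y, fun x y => xyFieldBond_comm n h x y⟩ e

/-- **The rotated (real) weighted field Hamiltonian** `H♭_w(h) = Σ_{⟨xy⟩} w_{xy} τ_h(x, y)`
(`τ_h = xyRealBond`, [KLS1988JSP] eqs. (15)–(17)). [cite: KLS1988JSP, eqs. (15)–(17)] -/
def xyWeightedRealFieldHamiltonian (w : Sym2 (TorusSite d L) → ℝ) (h : TorusSite d L → ℝ) :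
    Op (TorusSite d L) (n + 1) :=
  ∑ e ∈ (torusGraph d L).edgeFinset,
    ((w e : ℝ) : ℂ) • Sym2.lift ⟨fun x y => xyRealBond n h x y, fun x y => xyRealBond_comm n h x y⟩ e

/-- `H_w(0) = H_w` ([KLS1988JSP] after eq. (17)). [cite: KLS1988JSP, eq. (17)] -/
theorem xyWeightedFieldHamiltonian_zero (w : Sym2 (TorusSite d L) → ℝ) :
    xyWeightedFieldHamiltonian L n w (fun _ => 0) = xyWeightedHamiltonian L n w := by
  unfold xyWeightedFieldHamiltonian xyWeightedHamiltonian
  refine sum_congr rfl fun e _ => ?_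
  congr 1
  induction e using Sym2.ind with
  | h x y => simp only [Sym2.lift_mk, xyFieldBond_zero]

/-- **No bad bonds ⇒ `H_w(h) = H_w`**: if `h_x = h_y` on every bond then the field terms vanish
([KLS1988JSP] p. 1027: "(18) is equivalent to proving that E(h) attains its minimum when `h_x` is
a constant"). [cite: KLS1988JSP, p. 1027] -/
theorem xyWeightedFieldHamiltonian_eq_of_badBondCount_eq_zero (w : Sym2 (TorusSite d L) → ℝ)
    {h : TorusSite d L → ℝ} (h0 : badBondCount L h = 0) :
    xyWeightedFieldHamiltonian L n w h = xyWeightedHamiltonian L n w := by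
  classical
  rw [badBondCount, Finset.card_eq_zero, Finset.filter_eq_empty_iff] at h0
  unfold xyWeightedFieldHamiltonian xyWeightedHamiltonian
  refine sum_congr rfl fun e he => ?_
  congr 1
  have h1 := h0 he
  revert h1
  induction e using Sym2.ind with
  | h x y =>
    intro h1
    rw [not_not, Sym2.map_mk, Sym2.mk_isDiag_iff] at h1
    simp only [Sym2.lift_mk, xyFieldBond_of_eq n h1]

/-- `H♭_w(h)` is Hermitian (real symmetric bond terms). [cite: KLS1988JSP, eqs. (16)–(17)] -/
theorem xyWeightedRealFieldHamiltonian_isHermitian (w : Sym2 (TorusSite d L) → ℝ)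
    (h : TorusSite d L → ℝ) : (xyWeightedRealFieldHamiltonian L n w h).IsHermitian := by
  unfold xyWeightedRealFieldHamiltonian
  rw [IsHermitian, conjTranspose_sum]
  refine sum_congr rfl fun e _ => ?_
  rw [conjTranspose_smul, (isSelfAdjoint_ofReal _).star_eq]
  congr 1
  induction e using Sym2.ind with
  | h x y => exact (xyRealBond_isHermitian n h x y).eq

/-- The field bond term is Hermitian. [cite: KLS1988JSP, eq. (17)] -/
theorem xyFieldBond_isHermitian (h : Λ → ℝ) (x y : Λ) : (xyFieldBond n h x y).IsHermitian := by
  unfold xyFieldBond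
  refine ((((spinBond_isHermitian n 0 x y).neg).sub (spinBond_isHermitian n 1 x y)).sub
    (((siteSpin_isHermitian n x 0).sub (siteSpin_isHermitian n y 0)).smul
      (isSelfAdjoint_ofReal _))).add (isHermitian_one.smul (isSelfAdjoint_ofReal _))

/-- `H_w(h)` is Hermitian. [cite: KLS1988JSP, eq. (17)] -/
theorem xyWeightedFieldHamiltonian_isHermitian (w : Sym2 (TorusSite d L) → ℝ)
    (h : TorusSite d L → ℝ) : (xyWeightedFieldHamiltonian L n w h).IsHermitian := by
  unfold xyWeightedFieldHamiltonian
  rw [IsHermitian, conjTranspose_sum]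
  refine sum_congr rfl fun e _ => ?_
  rw [conjTranspose_smul, (isSelfAdjoint_ofReal _).star_eq]
  congr 1
  induction e using Sym2.ind with
  | h x y => exact (xyFieldBond_isHermitian n h x y).eq

/-- `H_w` is Hermitian. [cite: KLS1988JSP, eq. (5)] -/
theorem xyWeightedHamiltonian_isHermitian (w : Sym2 (TorusSite d L) → ℝ) :
    (xyWeightedHamiltonian L n w).IsHermitian := by
  rw [← xyWeightedFieldHamiltonian_zero]
  exact xyWeightedFieldHamiltonian_isHermitian L n w _

end Defs

/-! ### The weighted half-space operators and the Kronecker form -/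

section Halves

variable (L : ℕ) [NeZero L] (j : Fin d) (a : ZMod L) (hL : Even L) (n : ℕ)

/-- **The weighted left Hamiltonian** `A_w(h)`: the weighted rotated bond terms of the left bonds
plus `w_{x,θx}(½h_x² - h_x T¹_x)` over the left endpoints `x` of the crossing bonds
([KLS1988JSP] eq. (21), `H^L`, with the couplings of eq. (5)). [cite: KLS1988JSP, eqs. (5), (21)] -/
def xyWeightedLeftHamiltonian (w : Sym2 (TorusSite d L) → ℝ) (h : TorusSite d L → ℝ) :
    Op (torusLeftHalf L j a) (n + 1) :=
  (∑ e ∈ torusLeftEdges L j a, ((w e : ℝ) : ℂ) •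
    Sym2.lift ⟨fun x y => xyRealBond n (fun z : torusLeftHalf L j a => h z)
        (torusToLeft L j a hL x) (torusToLeft L j a hL y),
      fun _ _ => xyRealBond_comm n _ _ _⟩ e) +
  ∑ x ∈ torusCrossSites L j a, ((w s(x, Torus.reflectBetweenSites j a x) : ℝ) : ℂ) •
    ((((h x) ^ 2 / 2 : ℝ) : ℂ) • (1 : Op (torusLeftHalf L j a) (n + 1)) -
      ((h x : ℝ) : ℂ) • siteSpin n (torusToLeft L j a hL x) 0)

/-- **The weighted crossing operators** `√(w_{x,θx}) · Mᵢ(h)` ([KLS1988JSP] eq. (21): the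
crossing bond `{x, θx}` contributes `-w_{x,θx}[(T¹_x - h_x) ⊗ (T¹_x - h_{θx}) + T²_x ⊗ T²_x]`,
split symmetrically with the real scalar `√w`). [cite: KLS1988JSP, eqs. (20)–(21)] -/
def xyWeightedCrossOp (w : Sym2 (TorusSite d L) → ℝ) (h : TorusSite d L → ℝ) :
    torusCrossSites L j a × Bool → Op (torusLeftHalf L j a) (n + 1) := fun i =>
  ((Real.sqrt (w s((i.1 : TorusSite d L), Torus.reflectBetweenSites j a i.1)) : ℝ) : ℂ) •
    xyCrossOp L j a hL n h i

variable {L j a hL n}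

/-- `A_w(h)` is Hermitian. [cite: KLS1988JSP, eq. (21)] -/
theorem xyWeightedLeftHamiltonian_isHermitian (w : Sym2 (TorusSite d L) → ℝ)
    (h : TorusSite d L → ℝ) : (xyWeightedLeftHamiltonian L j a hL n w h).IsHermitian := by
  unfold xyWeightedLeftHamiltonian
  refine Matrix.IsHermitian.add ?_ ?_
  · rw [IsHermitian, conjTranspose_sum]
    refine sum_congr rfl fun e _ => ?_
    rw [conjTranspose_smul, (isSelfAdjoint_ofReal _).star_eq]
    congr 1
    induction e using Sym2.ind with
    | h x y =>
      simp only [Sym2.lift_mk]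
      exact (xyRealBond_isHermitian n _ _ _).eq
  · rw [IsHermitian, conjTranspose_sum]
    refine sum_congr rfl fun x _ => ?_
    rw [conjTranspose_smul, (isSelfAdjoint_ofReal _).star_eq]
    congr 1
    exact ((isHermitian_one.smul (isSelfAdjoint_ofReal _)).sub
      ((siteSpin_isHermitian n _ 0).smul (isSelfAdjoint_ofReal _))).eq

/-- `A_w(h)` is a real matrix. [cite: KLS1988JSP, p. 1028] -/
theorem xyWeightedLeftHamiltonian_transpose_eq (w : Sym2 (TorusSite d L) → ℝ)
    (h : TorusSite d L → ℝ) :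
    (xyWeightedLeftHamiltonian L j a hL n w h)ᵀ = (xyWeightedLeftHamiltonian L j a hL n w h)ᴴ := by
  unfold xyWeightedLeftHamiltonian
  rw [transpose_add, conjTranspose_add, transpose_sum, conjTranspose_sum, transpose_sum,
    conjTranspose_sum]
  congr 1
  · refine sum_congr rfl fun e _ => ?_
    refine transpose_eq_conjTranspose_ofReal_smul ?_ _
    induction e using Sym2.ind with
    | h x y =>
      simp only [Sym2.lift_mk]
      exact xyRealBond_transpose_eq n _ _ _
  · refine sum_congr rfl fun x _ => ?_
    exact transpose_eq_conjTranspose_ofReal_smul (transpose_eq_conjTranspose_sub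
      (transpose_eq_conjTranspose_ofReal_smul transpose_eq_conjTranspose_one _)
      (transpose_eq_conjTranspose_ofReal_smul (siteSpin_zero_transpose_eq n _) _)) _

/-- `A_w(h)` is complex-symmetric (real and Hermitian). [cite: KLS1988JSP, eq. (21), p. 1028] -/
theorem xyWeightedLeftHamiltonian_transpose (w : Sym2 (TorusSite d L) → ℝ)
    (h : TorusSite d L → ℝ) :
    (xyWeightedLeftHamiltonian L j a hL n w h)ᵀ = xyWeightedLeftHamiltonian L j a hL n w h := by
  rw [xyWeightedLeftHamiltonian_transpose_eq, (xyWeightedLeftHamiltonian_isHermitian w h).eq]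

/-- The weighted crossing operators are real matrices. [cite: KLS1988JSP, p. 1028] -/
theorem xyWeightedCrossOp_transpose_eq (w : Sym2 (TorusSite d L) → ℝ) (h : TorusSite d L → ℝ)
    (i : torusCrossSites L j a × Bool) :
    (xyWeightedCrossOp L j a hL n w h i)ᵀ = (xyWeightedCrossOp L j a hL n w h i)ᴴ :=
  transpose_eq_conjTranspose_ofReal_smul (xyCrossOp_transpose_eq L j a n hL h i) _

/-- `A_w(h)` depends on `h` only through `h` on the left half ([KLS1988JSP] p. 1028: `H^L`
"depends only on the left sites"). [cite: KLS1988JSP, eq. (21), p. 1028] -/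
theorem xyWeightedLeftHamiltonian_congr (w : Sym2 (TorusSite d L) → ℝ) {h₁ h₂ : TorusSite d L → ℝ}
    (hh : ∀ x ∈ torusLeftHalf L j a, h₁ x = h₂ x) :
    xyWeightedLeftHamiltonian L j a hL n w h₁ = xyWeightedLeftHamiltonian L j a hL n w h₂ := by
  unfold xyWeightedLeftHamiltonian
  congr 1
  · refine sum_congr rfl fun e _ => ?_
    congr 1
    induction e using Sym2.ind with
    | h x y =>
      simp only [Sym2.lift_mk]
      exact xyRealBond_congr n (hh _ (torusToLeft L j a hL x).2) (hh _ (torusToLeft L j a hL y).2)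
  · refine sum_congr rfl fun x hx => ?_
    rw [hh x (mem_filter.1 hx).1]

/-- The weighted crossing operators depend on `h` only through `h` on the left half. [cite: KLS1988JSP, eq. (21), p. 1028] -/
theorem xyWeightedCrossOp_congr (w : Sym2 (TorusSite d L) → ℝ) {h₁ h₂ : TorusSite d L → ℝ}
    (hh : ∀ x ∈ torusLeftHalf L j a, h₁ x = h₂ x) :
    xyWeightedCrossOp L j a hL n w h₁ = xyWeightedCrossOp L j a hL n w h₂ := by
  funext i
  simp only [xyWeightedCrossOp, xyCrossOp_congr L j a n hL hh]

variable (L j a hL n)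

/-- **The Kronecker form of the weighted rotated field Hamiltonian** ([KLS1988JSP] eq. (21) for
the couplings of eq. (5)): for a nonnegative weight invariant under the reflection `θ` in the
chosen planes, `H♭_w(g) = A_w(g) ⊗ 1 + 1 ⊗ A_w(g ∘ θ) - Σᵢ (√w Mᵢ(g)) ⊗ (√w Mᵢ(g ∘ θ))`.
[cite: KLS1988JSP, eqs. (5), (20)–(21)] -/
theorem xyWeightedRealFieldHamiltonian_eq_submatrix {w : Sym2 (TorusSite d L) → ℝ}
    (hw0 : ∀ e, 0 ≤ w e)
    (hwθ : ∀ e, w (e.map (Torus.reflectBetweenSites j a)) = w e) (g : TorusSite d L → ℝ) :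
    xyWeightedRealFieldHamiltonian L n w g =
      (xyWeightedLeftHamiltonian L j a hL n w g ⊗ₖ (1 : Op (torusLeftHalf L j a) (n + 1)) +
          (1 : Op (torusLeftHalf L j a) (n + 1)) ⊗ₖ
            xyWeightedLeftHamiltonian L j a hL n w (fun y => g (Torus.reflectBetweenSites j a y)) -
          ∑ i, xyWeightedCrossOp L j a hL n w g i ⊗ₖ
            xyWeightedCrossOp L j a hL n w (fun y => g (Torus.reflectBetweenSites j a y)) i).submatrix
        (torusSplit L j a hL) (torusSplit L j a hL) := by
  rw [submatrix_kroneckerForm, xyWeightedRealFieldHamiltonian, sum_edgeFinset_split L j a hL]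
  -- names for the half-space summands
  set TL : Sym2 (TorusSite d L) → Op (torusLeftHalf L j a) (n + 1) := fun e =>
    Sym2.lift ⟨fun x y => xyRealBond n (fun z : torusLeftHalf L j a => g z)
      (torusToLeft L j a hL x) (torusToLeft L j a hL y),
      fun x y => xyRealBond_comm n _ _ _⟩ e with hTL
  set TR : Sym2 (TorusSite d L) → Op (torusLeftHalf L j a) (n + 1) := fun e =>
    Sym2.lift ⟨fun x y => xyRealBond n (fun z : torusLeftHalf L j a => g (Torus.reflectBetweenSites j a z))
      (torusToLeft L j a hL x) (torusToLeft L j a hL y),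
      fun x y => xyRealBond_comm n _ _ _⟩ e with hTR
  -- (1) left bonds
  have h1 : ∑ e ∈ torusLeftEdges L j a, ((w e : ℝ) : ℂ) •
      Sym2.lift ⟨fun x y => xyRealBond n g x y, fun x y => xyRealBond_comm n g x y⟩ e =
        torusLeftEmbed L j a hL (∑ e ∈ torusLeftEdges L j a, ((w e : ℝ) : ℂ) • TL e) := by
    rw [map_sum]
    refine sum_congr rfl fun e he => ?_
    rw [map_smul]
    congr 1
    obtain ⟨-, hl⟩ := mem_filter.1 he
    revert hl
    refine Sym2.ind (fun x y => ?_) e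
    intro hl
    simp only [hTL, Sym2.lift_mk]
    exact xyRealBond_eq_torusLeftEmbed n g (hl x (Sym2.mem_mk_left x y))
      (hl y (Sym2.mem_mk_right x y))
  -- (2) right bonds
  have h2 : ∑ e ∈ ((torusGraph d L).edgeFinset.filter fun e => ∀ x ∈ e, x ∉ torusLeftHalf L j a),
      ((w e : ℝ) : ℂ) •
        Sym2.lift ⟨fun x y => xyRealBond n g x y, fun x y => xyRealBond_comm n g x y⟩ e =
        torusRightEmbed L j a hL (∑ e ∈ torusLeftEdges L j a, ((w e : ℝ) : ℂ) • TR e) := by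
    rw [← sum_rightEdges_eq_sum_leftEdges L j a hL (fun e => ((w e : ℝ) : ℂ) • TR e), map_sum]
    · refine sum_congr rfl fun e he => ?_
      rw [map_smul]
      congr 1
      obtain ⟨-, hr⟩ := mem_filter.1 he
      revert hr
      refine Sym2.ind (fun x y => ?_) e
      intro hr
      simp only [hTR, Sym2.lift_mk]
      exact xyRealBond_eq_torusRightEmbed n g (hr x (Sym2.mem_mk_left x y))
        (hr y (Sym2.mem_mk_right x y))
    · intro e
      rw [hwθ e]
      congr 1
      refine Sym2.ind (fun x y => ?_) e
      simp only [hTR, Sym2.map_mk, Sym2.lift_mk, torusToLeft_reflectBetweenSites]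
  -- (3) crossing bonds
  have h3 : ∑ x ∈ torusCrossSites L j a, ((w s(x, Torus.reflectBetweenSites j a x) : ℝ) : ℂ) •
      Sym2.lift ⟨fun x y => xyRealBond n g x y, fun x y => xyRealBond_comm n g x y⟩
        s(x, Torus.reflectBetweenSites j a x) =
      torusLeftEmbed L j a hL (∑ x ∈ torusCrossSites L j a,
          ((w s(x, Torus.reflectBetweenSites j a x) : ℝ) : ℂ) •
          ((((g x) ^ 2 / 2 : ℝ) : ℂ) • (1 : Op (torusLeftHalf L j a) (n + 1)) -
            ((g x : ℝ) : ℂ) • siteSpin n (torusToLeft L j a hL x) 0)) +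
        torusRightEmbed L j a hL (∑ x ∈ torusCrossSites L j a,
          ((w s(x, Torus.reflectBetweenSites j a x) : ℝ) : ℂ) •
          ((((g (Torus.reflectBetweenSites j a x)) ^ 2 / 2 : ℝ) : ℂ) • (1 : Op (torusLeftHalf L j a) (n + 1)) -
            ((g (Torus.reflectBetweenSites j a x) : ℝ) : ℂ) • siteSpin n (torusToLeft L j a hL x) 0)) -
        ∑ i : torusCrossSites L j a × Bool, torusLeftEmbed L j a hL (xyWeightedCrossOp L j a hL n w g i) *
          torusRightEmbed L j a hL
            (xyWeightedCrossOp L j a hL n w (fun y => g (Torus.reflectBetweenSites j a y)) i) := by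
    rw [map_sum, map_sum, Fintype.sum_prod_type]
    simp only [Fintype.sum_bool]
    rw [← Finset.sum_coe_sort (torusCrossSites L j a), ← Finset.sum_coe_sort (torusCrossSites L j a),
      ← Finset.sum_coe_sort (torusCrossSites L j a), ← sum_add_distrib, ← sum_sub_distrib]
    refine sum_congr rfl fun x _ => ?_
    have hsq : ((Real.sqrt (w s((x : TorusSite d L), Torus.reflectBetweenSites j a x)) : ℝ) : ℂ) *
        ((Real.sqrt (w s((x : TorusSite d L), Torus.reflectBetweenSites j a x)) : ℝ) : ℂ) =
        ((w s((x : TorusSite d L), Torus.reflectBetweenSites j a x) : ℝ) : ℂ) := by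
      rw [← Complex.ofReal_mul, Real.mul_self_sqrt (hw0 _)]
    simp only [Sym2.lift_mk]
    rw [xyRealBond_cross (hL := hL) n g x, map_smul, map_smul]
    simp only [xyWeightedCrossOp, map_smul, smul_mul_smul_comm, hsq, smul_add, smul_sub]
  rw [h1, h2, h3, xyWeightedLeftHamiltonian, xyWeightedLeftHamiltonian, map_add, map_add]
  abel

end Halves


/-! ### The sublattice rotation, bond by bond -/

section Rotation

variable (L : ℕ) [NeZero L]

/-- **The sublattice rotation, bond by bond** ([KLS1988JSP] eqs. (15)–(16); [DLS1978] §2): on the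
even torus of side `L ≥ 3` and for every spin `n/2`, the rotation by `π` about the `1`-axis on
the odd sublattice is ONE unitary `W` with `W τ⁰_h(x,y) Wᴴ = τ_h(x,y)` for every bond `{x,y}` of
the torus graph and every real field `h` (`τ⁰_h = xyFieldBond`, `τ_h = xyRealBond`): the
bond-wise content of `exists_unitary_conj_xyFieldHamiltonian`, so that every WEIGHTED bond sum is
conjugated into its real form. [cite: KLS1988JSP, eqs. (15)–(17)] [cite: DysonLiebSimon1978, §2] -/
theorem exists_unitary_conj_xyFieldBond (hL : Even L) (hL3 : 3 ≤ L) (n : ℕ) :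
    ∃ W ∈ Matrix.unitaryGroup (TensorIndex (TorusSite d L) (n + 1)) ℂ,
      ∀ (h : TorusSite d L → ℝ), ∀ e ∈ (torusGraph d L).edgeFinset,
        W * Sym2.lift ⟨fun x y => xyFieldBond n h x y, fun x y => xyFieldBond_comm n h x y⟩ e * Wᴴ =
          Sym2.lift ⟨fun x y => xyRealBond n h x y, fun x y => xyRealBond_comm n h x y⟩ e := by
  obtain ⟨k, rfl⟩ : ∃ k, L = 2 * k := ⟨L / 2, by obtain ⟨k, hk⟩ := hL; omega⟩
  set E := (torusGraph d (2 * k)).edgeFinset with hE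
  -- the single-site rotation `R₁ = D² V²` (`π` about the `1`-axis): `Sˣ ↦ Sˣ`, `Sʸ ↦ -Sʸ`
  obtain ⟨V, hV, hV', hVz, hVx, hVy⟩ := exists_unitary_conj_spinZ_eq_spinX n
  obtain ⟨D, hD, hD', hDx, hDy, hDz⟩ := exists_unitary_conj_spinX_eq_neg_spinY n
  set R₁ := D * D * (V * V) with hR₁
  have hR₁R₁ : R₁ * R₁ᴴ = 1 := by
    rw [hR₁]
    simp only [conjTranspose_mul, Matrix.mul_assoc]
    rw [← Matrix.mul_assoc V Vᴴ, hV, Matrix.one_mul, ← Matrix.mul_assoc V Vᴴ, hV, Matrix.one_mul,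
      ← Matrix.mul_assoc D Dᴴ, hD, Matrix.one_mul, hD]
  have hR₁R₁' : R₁ᴴ * R₁ = 1 := by
    rw [hR₁]
    simp only [conjTranspose_mul, Matrix.mul_assoc]
    rw [← Matrix.mul_assoc Dᴴ D, hD', Matrix.one_mul, ← Matrix.mul_assoc Dᴴ D, hD', Matrix.one_mul,
      ← Matrix.mul_assoc Vᴴ V, hV', Matrix.one_mul, hV']
  have hconj : ∀ (A B M : Matrix (Fin (n + 1)) (Fin (n + 1)) ℂ),
      A * B * M * (A * B)ᴴ = A * (B * M * Bᴴ) * Aᴴ := by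
    intro A B M
    rw [conjTranspose_mul]
    simp only [Matrix.mul_assoc]
  have hR₁x : R₁ * spinX n * R₁ᴴ = spinX n := by
    rw [hR₁, hconj, hconj V V, hVx, Matrix.mul_neg, Matrix.neg_mul, hVz, hconj D D, Matrix.mul_neg,
      Matrix.neg_mul, hDx, neg_neg, hDy]
  have hR₁y : R₁ * spinY n * R₁ᴴ = -spinY n := by
    rw [hR₁, hconj, hconj V V, hVy, hVy, hconj D D, hDy, hDx]
  -- the product unitary on the odd sublattice
  set ε : TorusSite d (2 * k) → ZMod 2 := fun x =>
    ∑ j, ZMod.castHom (dvd_mul_right 2 k) (ZMod 2) (x j) with hε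
  set u : TorusSite d (2 * k) → Matrix (Fin (n + 1)) (Fin (n + 1)) ℂ :=
    fun z => if ε z = 0 then 1 else R₁ with hu
  have hua : ∀ z, u z * (u z)ᴴ = 1 := by
    intro z; simp only [hu]; split_ifs
    · rw [conjTranspose_one, Matrix.mul_one]
    · exact hR₁R₁
  have hua' : ∀ z, (u z)ᴴ * u z = 1 := by
    intro z; simp only [hu]; split_ifs
    · rw [conjTranspose_one, Matrix.mul_one]
    · exact hR₁R₁'
  set sgn : TorusSite d (2 * k) → ℂ := fun z => if ε z = 0 then 1 else -1 with hsgn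
  have hux : ∀ z, u z * spinX n * (u z)ᴴ = spinX n := by
    intro z; simp only [hu]; split_ifs
    · rw [conjTranspose_one, Matrix.mul_one, Matrix.one_mul]
    · exact hR₁x
  have huy : ∀ z, u z * spinY n * (u z)ᴴ = sgn z • spinY n := by
    intro z; simp only [hu, hsgn]; split_ifs
    · rw [conjTranspose_one, Matrix.mul_one, Matrix.one_mul, one_smul]
    · rw [hR₁y, neg_one_smul]
  have hedge : ∀ e ∈ E, ∀ x y, e = s(x, y) → sgn x * sgn y = -1 := by
    intro e he x y hexy
    subst hexy
    rw [hE, SimpleGraph.mem_edgeFinset, SimpleGraph.mem_edgeSet, torusGraph_adj_iff] at he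
    have h01 : ∀ t : ZMod 2, t = 0 ∨ t = 1 := by decide
    have key : ∀ x' : TorusSite d (2 * k), ∀ i, sgn x' * sgn (x' + Pi.single i 1) = -1 := by
      intro x' i
      have hpar : ε (x' + Pi.single i 1) = ε x' + 1 := torusParity_add_single k x' i
      simp only [hsgn, hpar]
      rcases h01 (ε x') with h0 | h1
      · rw [if_pos h0, if_neg (by rw [h0]; decide), one_mul]
      · rw [if_neg (by rw [h1]; decide), if_pos (by rw [h1]; decide), mul_one]
    obtain ⟨-, ⟨i, rfl⟩ | ⟨i, rfl⟩⟩ := he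
    · exact key x i
    · rw [mul_comm]; exact key y i
  set W := productOp u with hW
  have hWx : ∀ x : TorusSite d (2 * k), W * siteSpin n x 0 * Wᴴ = siteSpin n x 0 := by
    intro x
    rw [hW, productOp_conj_siteSpin hua, spinVec_zero, hux]
    rfl
  have hb0 : ∀ x y : TorusSite d (2 * k), W * spinBond n 0 x y * Wᴴ = spinBond n 0 x y := by
    intro x y
    rw [hW, productOp_conj_spinBond hua hua', spinVec_zero, hux, hux, spinBond]
    rfl
  have hb1 : ∀ x y : TorusSite d (2 * k), sgn x * sgn y = -1 →
      W * spinBond n 1 x y * Wᴴ = -spinBond n 1 x y := by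
    intro x y hxy
    rw [hW, productOp_conj_spinBond hua hua', spinVec_one, huy, huy, onSite_smul', onSite_smul',
      smul_mul_smul_comm, smul_mul_smul_comm, mul_comm (sgn y) (sgn x), hxy, spinBond]
    simp only [neg_smul, one_smul]
    rw [← neg_add, smul_neg]
    rfl
  have hW1 : W * (1 : Op (TorusSite d (2 * k)) (n + 1)) * Wᴴ = 1 := by
    rw [Matrix.mul_one, hW, productOp_mul_conjTranspose hua]
  refine ⟨W, Matrix.mem_unitaryGroup_iff.2 (by rw [hW]; exact productOp_mul_conjTranspose hua),
    fun h e he => ?_⟩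
  induction e using Sym2.ind with
  | h x y =>
    have hs := hedge _ he x y rfl
    simp only [Sym2.lift_mk, xyRealBond, xyFieldBond, Matrix.mul_add, Matrix.add_mul, Matrix.mul_sub,
      Matrix.sub_mul, Matrix.mul_neg, Matrix.neg_mul, Matrix.mul_smul, Matrix.smul_mul, hb0,
      hb1 x y hs, hW1, hWx]
    abel

/-- `W H_w(h) Wᴴ = H♭_w(h)` for the unitary of `exists_unitary_conj_xyFieldBond`: the weighted
field Hamiltonian is unitarily equivalent to its real form. [cite: KLS1988JSP, eqs. (15)–(17)] -/
theorem exists_unitary_conj_xyWeightedFieldHamiltonian (hL : Even L) (hL3 : 3 ≤ L) (n : ℕ) :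
    ∃ W ∈ Matrix.unitaryGroup (TensorIndex (TorusSite d L) (n + 1)) ℂ,
      ∀ (w : Sym2 (TorusSite d L) → ℝ) (h : TorusSite d L → ℝ),
        W * xyWeightedFieldHamiltonian L n w h * Wᴴ = xyWeightedRealFieldHamiltonian L n w h := by
  obtain ⟨W, hWu, hW⟩ := exists_unitary_conj_xyFieldBond (d := d) L hL hL3 n
  refine ⟨W, hWu, fun w h => ?_⟩
  rw [xyWeightedFieldHamiltonian, xyWeightedRealFieldHamiltonian, Finset.mul_sum, Finset.sum_mul]
  refine sum_congr rfl fun e he => ?_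
  rw [Matrix.mul_smul, Matrix.smul_mul, hW h e he]

/-- `E₀(H_w(h)) = E₀(H♭_w(h))` (even side `L ≥ 3`). [cite: KLS1988JSP, eqs. (15)–(17)] -/
theorem groundEnergy_xyWeightedFieldHamiltonian_eq (hL : Even L) (hL3 : 3 ≤ L) (n : ℕ)
    (w : Sym2 (TorusSite d L) → ℝ) (h : TorusSite d L → ℝ) :
    (xyWeightedFieldHamiltonian L n w h).groundEnergy =
      (xyWeightedRealFieldHamiltonian L n w h).groundEnergy := by
  obtain ⟨W, hWu, hW⟩ := exists_unitary_conj_xyWeightedFieldHamiltonian (d := d) L hL hL3 n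
  rw [← hW w h, Matrix.groundEnergy_unitary_conj hWu]

/-- `Z_β(H_w(h)) = Z_β(H♭_w(h))` (even side `L ≥ 3`). [cite: DysonLiebSimon1978, §2 and Thm. 4.2] -/
theorem partitionFn_xyWeightedFieldHamiltonian_eq (hL : Even L) (hL3 : 3 ≤ L) (n : ℕ) (β : ℝ)
    (w : Sym2 (TorusSite d L) → ℝ) (h : TorusSite d L → ℝ) :
    partitionFn β (xyWeightedFieldHamiltonian L n w h) =
      partitionFn β (xyWeightedRealFieldHamiltonian L n w h) := by
  obtain ⟨W, hWu, hW⟩ := exists_unitary_conj_xyWeightedFieldHamiltonian (d := d) L hL hL3 n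
  have hWu' : W ∈ unitary (Matrix (TensorIndex (TorusSite d L) (n + 1))
      (TensorIndex (TorusSite d L) (n + 1)) ℂ) := hWu
  rw [← hW w h, ← star_eq_conjTranspose, partitionFn_unitary_conj hWu']

end Rotation

/-! ### The reflection inequalities along one pair of planes -/

section Reflection

variable (L : ℕ) [NeZero L] (j : Fin d) (a : ZMod L) (n : ℕ)

/-- **The reflection inequality for the ground-state energy, weighted couplings**
([KLS1988JSP], the display after eq. (25), for the couplings of eq. (5)): for a nonnegative
weight invariant under the reflection in the chosen planes, `½E_w(h^L) + ½E_w(h^R) ≤ E_w(h)`.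
[cite: KLS1988JSP, eqs. (5), (20)–(25)] -/
theorem groundEnergy_reflect_le_weighted (hL : Even L) (hL3 : 3 ≤ L) {w : Sym2 (TorusSite d L) → ℝ}
    (hw0 : ∀ e, 0 ≤ w e) (hwθ : ∀ e, w (e.map (Torus.reflectBetweenSites j a)) = w e)
    (h : TorusSite d L → ℝ) :
    ((xyWeightedFieldHamiltonian L n w (reflectFieldLeft L j a h)).groundEnergy +
        (xyWeightedFieldHamiltonian L n w (reflectFieldRight L j a h)).groundEnergy) / 2 ≤
      (xyWeightedFieldHamiltonian L n w h).groundEnergy := by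
  rw [groundEnergy_xyWeightedFieldHamiltonian_eq L hL hL3,
    groundEnergy_xyWeightedFieldHamiltonian_eq L hL hL3,
    groundEnergy_xyWeightedFieldHamiltonian_eq L hL hL3]
  -- abbreviations
  set A := xyWeightedLeftHamiltonian L j a hL n w h with hA
  set B := xyWeightedLeftHamiltonian L j a hL n w (fun y => h (Torus.reflectBetweenSites j a y)) with hB
  set M := xyWeightedCrossOp L j a hL n w h with hM
  set N := xyWeightedCrossOp L j a hL n w (fun y => h (Torus.reflectBetweenSites j a y)) with hN
  set e := torusSplit (q := n + 1) L j a hL with he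
  -- the three Kronecker forms
  have hK : xyWeightedRealFieldHamiltonian L n w h =
      (A ⊗ₖ 1 + 1 ⊗ₖ B - ∑ i, M i ⊗ₖ N i).submatrix e e :=
    xyWeightedRealFieldHamiltonian_eq_submatrix L j a hL n hw0 hwθ h
  have hKL : xyWeightedRealFieldHamiltonian L n w (reflectFieldLeft L j a h) =
      (A ⊗ₖ 1 + 1 ⊗ₖ A - ∑ i, M i ⊗ₖ M i).submatrix e e := by
    rw [xyWeightedRealFieldHamiltonian_eq_submatrix L j a hL n hw0 hwθ,
      xyWeightedLeftHamiltonian_congr w (fun x hx => reflectFieldLeft_of_mem L j a h hx),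
      xyWeightedLeftHamiltonian_congr w
        (fun x hx => reflectFieldLeft_reflectBetweenSites_of_mem L j a hL h hx),
      xyWeightedCrossOp_congr w (fun x hx => reflectFieldLeft_of_mem L j a h hx),
      xyWeightedCrossOp_congr w
        (fun x hx => reflectFieldLeft_reflectBetweenSites_of_mem L j a hL h hx)]
  have hKR : xyWeightedRealFieldHamiltonian L n w (reflectFieldRight L j a h) =
      (B ⊗ₖ 1 + 1 ⊗ₖ B - ∑ i, N i ⊗ₖ N i).submatrix e e := by
    rw [xyWeightedRealFieldHamiltonian_eq_submatrix L j a hL n hw0 hwθ,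
      xyWeightedLeftHamiltonian_congr w (fun x hx => reflectFieldRight_of_mem L j a h hx),
      xyWeightedLeftHamiltonian_congr w
        (h₁ := fun y => reflectFieldRight L j a h (Torus.reflectBetweenSites j a y))
        (fun x hx => reflectFieldRight_reflectBetweenSites_of_mem L j a hL h hx),
      xyWeightedCrossOp_congr w (fun x hx => reflectFieldRight_of_mem L j a h hx),
      xyWeightedCrossOp_congr w
        (h₁ := fun y => reflectFieldRight L j a h (Torus.reflectBetweenSites j a y))
        (fun x hx => reflectFieldRight_reflectBetweenSites_of_mem L j a hL h hx)]
  -- Hermiticity of the three forms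
  have herm : ∀ (f : TorusSite d L → ℝ) (K : Matrix _ _ ℂ),
      xyWeightedRealFieldHamiltonian L n w f = K.submatrix e e → K.IsHermitian := by
    intro f K hf
    have : K = (xyWeightedRealFieldHamiltonian L n w f).submatrix e.symm e.symm := by
      rw [hf, submatrix_submatrix, Equiv.self_comp_symm, submatrix_id_id]
    rw [this]
    exact (xyWeightedRealFieldHamiltonian_isHermitian L n w f).submatrix _
  haveI : Nonempty ((torusLeftHalf L j a → Fin (n + 1)) × (torusLeftHalf L j a → Fin (n + 1))) :=
    ⟨(fun _ => 0, fun _ => 0)⟩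
  have hRP := Matrix.kls_groundEnergy_reflection A B M N
    (xyWeightedLeftHamiltonian_transpose w h) (xyWeightedLeftHamiltonian_transpose w _)
    (fun i => xyWeightedCrossOp_transpose_eq w h i) (fun i => xyWeightedCrossOp_transpose_eq w _ i)
    (herm _ _ hK) (herm _ _ hKL) (herm _ _ hKR)
  rw [hK, hKL, hKR, Matrix.groundEnergy_submatrix_equiv (herm _ _ hK),
    Matrix.groundEnergy_submatrix_equiv (herm _ _ hKL),
    Matrix.groundEnergy_submatrix_equiv (herm _ _ hKR)]
  exact hRP

/-- **The reflection inequality for the partition function, weighted couplings** ([DLS1978]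
Lemma 4.1 as in the proof of Thm. 4.2): for a nonnegative weight invariant under the reflection
in the chosen planes and every `β > 0`, `Z_w(h)² ≤ Z_w(h^L) Z_w(h^R)`,
`Z_w(f) = Tr exp(-βH_w(f))`. [cite: DysonLiebSimon1978, Lemma 4.1, Thm. 4.2] [cite: KLS1988JSP, eq. (5)] -/
theorem partitionFn_weighted_sq_le (hL : Even L) (hL3 : 3 ≤ L) {β : ℝ} (hβ : 0 < β)
    {w : Sym2 (TorusSite d L) → ℝ} (hw0 : ∀ e, 0 ≤ w e)
    (hwθ : ∀ e, w (e.map (Torus.reflectBetweenSites j a)) = w e) (h : TorusSite d L → ℝ) :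
    (partitionFn β (xyWeightedFieldHamiltonian L n w h)).re ^ 2 ≤
      (partitionFn β (xyWeightedFieldHamiltonian L n w (reflectFieldLeft L j a h))).re *
        (partitionFn β (xyWeightedFieldHamiltonian L n w (reflectFieldRight L j a h))).re := by
  -- positivity of the three partition functions
  have hZpos : ∀ f : TorusSite d L → ℝ, 0 < (partitionFn β (xyWeightedFieldHamiltonian L n w f)).re :=
    fun f => (partitionFn_re_pos β (xyWeightedFieldHamiltonian_isHermitian L n w f)).1
  have hx0 := hZpos h
  have hy0 := hZpos (reflectFieldLeft L j a h)
  have hz0 := hZpos (reflectFieldRight L j a h)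
  -- abbreviations
  set A := xyWeightedLeftHamiltonian L j a hL n w h with hA
  set B := xyWeightedLeftHamiltonian L j a hL n w (fun y => h (Torus.reflectBetweenSites j a y)) with hB
  set M := xyWeightedCrossOp L j a hL n w h with hM
  set N := xyWeightedCrossOp L j a hL n w (fun y => h (Torus.reflectBetweenSites j a y)) with hN
  set e := torusSplit (q := n + 1) L j a hL with he
  have hK : xyWeightedRealFieldHamiltonian L n w h =
      (A ⊗ₖ 1 + 1 ⊗ₖ B - ∑ i, M i ⊗ₖ N i).submatrix e e :=
    xyWeightedRealFieldHamiltonian_eq_submatrix L j a hL n hw0 hwθ h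
  have hKL : xyWeightedRealFieldHamiltonian L n w (reflectFieldLeft L j a h) =
      (A ⊗ₖ 1 + 1 ⊗ₖ A - ∑ i, M i ⊗ₖ M i).submatrix e e := by
    rw [xyWeightedRealFieldHamiltonian_eq_submatrix L j a hL n hw0 hwθ,
      xyWeightedLeftHamiltonian_congr w (fun x hx => reflectFieldLeft_of_mem L j a h hx),
      xyWeightedLeftHamiltonian_congr w
        (fun x hx => reflectFieldLeft_reflectBetweenSites_of_mem L j a hL h hx),
      xyWeightedCrossOp_congr w (fun x hx => reflectFieldLeft_of_mem L j a h hx),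
      xyWeightedCrossOp_congr w
        (fun x hx => reflectFieldLeft_reflectBetweenSites_of_mem L j a hL h hx)]
  have hKR : xyWeightedRealFieldHamiltonian L n w (reflectFieldRight L j a h) =
      (B ⊗ₖ 1 + 1 ⊗ₖ B - ∑ i, N i ⊗ₖ N i).submatrix e e := by
    rw [xyWeightedRealFieldHamiltonian_eq_submatrix L j a hL n hw0 hwθ,
      xyWeightedLeftHamiltonian_congr w (fun x hx => reflectFieldRight_of_mem L j a h hx),
      xyWeightedLeftHamiltonian_congr w
        (h₁ := fun y => reflectFieldRight L j a h (Torus.reflectBetweenSites j a y))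
        (fun x hx => reflectFieldRight_reflectBetweenSites_of_mem L j a hL h hx),
      xyWeightedCrossOp_congr w (fun x hx => reflectFieldRight_of_mem L j a h hx),
      xyWeightedCrossOp_congr w
        (h₁ := fun y => reflectFieldRight L j a h (Torus.reflectBetweenSites j a y))
        (fun x hx => reflectFieldRight_reflectBetweenSites_of_mem L j a hL h hx)]
  -- partition functions as traces of exponentials of the DLS forms
  have hZ : ∀ (X Y : Op (torusLeftHalf L j a) (n + 1))
      (P Q : torusCrossSites L j a × Bool → Op (torusLeftHalf L j a) (n + 1)),
      partitionFn β ((X ⊗ₖ (1 : Op (torusLeftHalf L j a) (n + 1)) +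
        (1 : Op (torusLeftHalf L j a) (n + 1)) ⊗ₖ Y - ∑ i, P i ⊗ₖ Q i).submatrix e e) =
      (exp ((-(β : ℂ) • X) ⊗ₖ (1 : Op (torusLeftHalf L j a) (n + 1)) +
        (1 : Op (torusLeftHalf L j a) (n + 1)) ⊗ₖ (-(β : ℂ) • Y) +
        ∑ i, ((Real.sqrt β : ℂ) • P i) ⊗ₖ ((Real.sqrt β : ℂ) • Q i))).trace := by
    intro X Y P Q
    rw [partitionFn_submatrix_equiv, partitionFn, gibbsWeight, neg_smul_kroneckerForm hβ.le]
  -- reality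
  have hnegβ : ∀ {X : Op (torusLeftHalf L j a) (n + 1)}, Xᵀ = Xᴴ →
      (-(β : ℂ) • X)ᵀ = (-(β : ℂ) • X)ᴴ := by
    intro X hX
    have h := transpose_eq_conjTranspose_ofReal_smul hX (-β)
    rwa [Complex.ofReal_neg] at h
  have hAt : (-(β : ℂ) • A)ᵀ = (-(β : ℂ) • A)ᴴ := hnegβ (xyWeightedLeftHamiltonian_transpose_eq w h)
  have hBt : (-(β : ℂ) • B)ᵀ = (-(β : ℂ) • B)ᴴ := hnegβ (xyWeightedLeftHamiltonian_transpose_eq w _)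
  have hMt : ∀ i, ((Real.sqrt β : ℂ) • M i)ᵀ = ((Real.sqrt β : ℂ) • M i)ᴴ := fun i =>
    transpose_eq_conjTranspose_ofReal_smul (xyWeightedCrossOp_transpose_eq w h i) _
  have hNt : ∀ i, ((Real.sqrt β : ℂ) • N i)ᵀ = ((Real.sqrt β : ℂ) • N i)ᴴ := fun i =>
    transpose_eq_conjTranspose_ofReal_smul (xyWeightedCrossOp_transpose_eq w _ i) _
  haveI : Nonempty (torusLeftHalf L j a → Fin (n + 1)) := ⟨fun _ => 0⟩
  have hDLS := Matrix.trace_exp_kroneckerSum_le (m := torusLeftHalf L j a → Fin (n + 1))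
    (n := torusLeftHalf L j a → Fin (n + 1)) hAt hBt hMt hNt
  have hineq : (partitionFn β (xyWeightedFieldHamiltonian L n w h)).re ≤
      Real.sqrt (partitionFn β (xyWeightedFieldHamiltonian L n w (reflectFieldLeft L j a h))).re *
      Real.sqrt (partitionFn β (xyWeightedFieldHamiltonian L n w (reflectFieldRight L j a h))).re := by
    rw [partitionFn_xyWeightedFieldHamiltonian_eq L hL hL3,
      partitionFn_xyWeightedFieldHamiltonian_eq L hL hL3,
      partitionFn_xyWeightedFieldHamiltonian_eq L hL hL3, hK, hKL, hKR, hZ, hZ, hZ]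
    exact hDLS
  calc _ ≤ (Real.sqrt (partitionFn β (xyWeightedFieldHamiltonian L n w (reflectFieldLeft L j a h))).re *
      Real.sqrt (partitionFn β (xyWeightedFieldHamiltonian L n w (reflectFieldRight L j a h))).re) ^ 2 :=
        pow_le_pow_left₀ hx0.le hineq 2
    _ = _ := by rw [mul_pow, Real.sq_sqrt hy0.le, Real.sq_sqrt hz0.le]

end Reflection

/-! ### The descent: Gaussian domination for reflection-invariant weights -/

section Descent

variable (L : ℕ) [NeZero L] (n : ℕ)

/-- A bad bond of a field with positive bad-bond count, as a pair `(x₀, i)` with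
`h_{x₀} ≠ h_{x₀ + eᵢ}`. [folklore] -/
private theorem exists_bad_pair {h : TorusSite d L → ℝ} (hN : badBondCount L h ≠ 0) :
    ∃ (x₀ : TorusSite d L) (i : Fin d), h x₀ ≠ h (x₀ + Pi.single i 1) := by
  classical
  obtain ⟨e, he⟩ := Finset.card_ne_zero.1 hN
  obtain ⟨heE, hbe⟩ := mem_filter.1 he
  revert heE hbe
  refine Sym2.ind (fun u v => ?_) e
  intro heE hbe
  rw [SimpleGraph.mem_edgeFinset, SimpleGraph.mem_edgeSet, torusGraph_adj_iff] at heE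
  rw [Sym2.map_mk, Sym2.mk_isDiag_iff] at hbe
  obtain ⟨-, ⟨i, rfl⟩ | ⟨i, rfl⟩⟩ := heE
  · exact ⟨u, i, hbe⟩
  · exact ⟨v, i, fun h' => hbe h'.symm⟩

/-- **Ground-state Gaussian domination for reflection-invariant nonnegative bond weights**
([KLS1988JSP] eq. (18) for the couplings of eq. (5), XY version): on the even torus of side
`L ≥ 4`, for every spin, every weight `w ≥ 0` with `w(θe) = w(e)` for all the reflections
through bond planes, and every real field `h`, `E₀(H_w) ≤ E₀(H_w(h))`. Proof: the descent of
[KLS1988JSP] pp. 1027–1029 — minimise `E_w` over the finitely many fields with values in the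
range of `h`, then the number of bonds with `f_x ≠ f_y`; a bad bond and the planes through it give
`½E_w(f^L) + ½E_w(f^R) ≤ E_w(f)` (`groundEnergy_reflect_le_weighted`), and one of `f^L`, `f^R` has
fewer bad bonds (`badBondCount_reflect`); no bad bond forces `H_w(f) = H_w`.
[cite: KLS1988JSP, eqs. (5), (18), pp. 1027–1029] [cite: KLS1988PRL, after eq. (4)] -/
theorem xyWeighted_gaussianDomination_ground (hL : Even L) (h4 : 4 ≤ L)
    {w : Sym2 (TorusSite d L) → ℝ} (hw0 : ∀ e, 0 ≤ w e)
    (hwθ : ∀ (j : Fin d) (a : ZMod L) (e : Sym2 (TorusSite d L)),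
      w (e.map (Torus.reflectBetweenSites j a)) = w e)
    (g : TorusSite d L → ℝ) :
    (xyWeightedHamiltonian L n w).groundEnergy ≤
      (xyWeightedFieldHamiltonian L n w g).groundEnergy := by
  classical
  have hL3 : 3 ≤ L := by omega
  have hL2 : 2 ≤ L := by omega
  -- the finite search space
  set V : Finset ℝ := (univ : Finset (TorusSite d L)).image g with hV
  set Ef : (TorusSite d L → V) → ℝ := fun f =>
    (xyWeightedFieldHamiltonian L n w (fun x => (f x : ℝ))).groundEnergy with hEf
  set Nf : (TorusSite d L → V) → ℕ := fun f => badBondCount L (fun x => (f x : ℝ)) with hNf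
  set g' : TorusSite d L → V := fun x => ⟨g x, mem_image_of_mem g (mem_univ x)⟩ with hg'
  haveI : Nonempty (TorusSite d L → V) := ⟨g'⟩
  obtain ⟨f₀, hf₀⟩ := Finite.exists_min Ef
  set S : Finset (TorusSite d L → V) := univ.filter fun f => Ef f = Ef f₀ with hS
  obtain ⟨f₁, hf₁S, hf₁min⟩ := S.exists_min_image Nf ⟨f₀, by simp [hS]⟩
  have hEf₁ : Ef f₁ = Ef f₀ := (mem_filter.1 hf₁S).2
  -- the minimiser has no bad bonds
  have hN0 : Nf f₁ = 0 := by
    by_contra hN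
    obtain ⟨x₀, i, hbad⟩ := exists_bad_pair L hN
    -- the planes through the bad bond
    set j := i
    obtain ⟨hxCS, hθx⟩ := add_single_mem_torusCrossSites L hL2 j x₀
    set a : ZMod L := x₀ j with ha
    set φ : TorusSite d L → ℝ := fun x => (f₁ x : ℝ) with hφ
    set fL : TorusSite d L → V := fun y =>
      if y ∈ torusLeftHalf L j a then f₁ y else f₁ (Torus.reflectBetweenSites j a y) with hfL
    set fR : TorusSite d L → V := fun y =>
      if y ∈ torusLeftHalf L j a then f₁ (Torus.reflectBetweenSites j a y) else f₁ y with hfR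
    have hfLφ : (fun x => (fL x : ℝ)) = reflectFieldLeft L j a φ := by
      funext y
      simp only [hfL, reflectFieldLeft, hφ]
      split_ifs <;> rfl
    have hfRφ : (fun x => (fR x : ℝ)) = reflectFieldRight L j a φ := by
      funext y
      simp only [hfR, reflectFieldRight, hφ]
      split_ifs <;> rfl
    -- energies: both reflected fields are minimisers
    have hRP := groundEnergy_reflect_le_weighted L j a n hL hL3 hw0 (hwθ j a) φ
    have hEL : Ef fL = (xyWeightedFieldHamiltonian L n w (reflectFieldLeft L j a φ)).groundEnergy := by
      simp only [hEf, hfLφ]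
    have hER : Ef fR = (xyWeightedFieldHamiltonian L n w (reflectFieldRight L j a φ)).groundEnergy := by
      simp only [hEf, hfRφ]
    have hE1 : Ef f₁ = (xyWeightedFieldHamiltonian L n w φ).groundEnergy := by simp only [hEf, hφ]
    have h1 := hf₀ fL
    have h2 := hf₀ fR
    rw [← hEL, ← hER, ← hE1, hEf₁] at hRP
    have hELm : Ef fL = Ef f₀ := by linarith
    have hERm : Ef fR = Ef f₀ := by linarith
    have hNL : Nf f₁ ≤ Nf fL := hf₁min fL (by simp [hS, hELm])
    have hNR : Nf f₁ ≤ Nf fR := hf₁min fR (by simp [hS, hERm])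
    -- counting: `N(f^L) + N(f^R) + 2N_C = 2N(f)` with `N_C ≥ 1`
    have hcount := badBondCount_reflect L j a hL φ
    have hNLφ : Nf fL = badBondCount L (reflectFieldLeft L j a φ) := by simp only [hNf, hfLφ]
    have hNRφ : Nf fR = badBondCount L (reflectFieldRight L j a φ) := by simp only [hNf, hfRφ]
    have hN1φ : Nf f₁ = badBondCount L φ := by simp only [hNf, hφ]
    have hC : 1 ≤ ∑ x ∈ torusCrossSites L j a,
        (if (Sym2.map φ s(x, Torus.reflectBetweenSites j a x)).IsDiag then 0 else 1) := by
      have hone : (if (Sym2.map φ s(x₀ + Pi.single j 1,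
          Torus.reflectBetweenSites j a (x₀ + Pi.single j 1))).IsDiag then 0 else 1) = 1 := by
        simp only [hθx, Sym2.map_mk, Sym2.mk_isDiag_iff]
        rw [if_neg]
        exact fun h' => hbad h'.symm
      calc 1 = (if (Sym2.map φ s(x₀ + Pi.single j 1,
          Torus.reflectBetweenSites j a (x₀ + Pi.single j 1))).IsDiag then 0 else 1) := hone.symm
        _ ≤ _ := Finset.single_le_sum (f := fun x =>
          if (Sym2.map φ s(x, Torus.reflectBetweenSites j a x)).IsDiag then 0 else 1)
          (fun _ _ => Nat.zero_le _) hxCS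
    rw [← hNLφ, ← hNRφ, ← hN1φ] at hcount
    omega
  -- hence `H_w(f₁) = H_w` and `E₀(H_w) = E_w(f₁) ≤ E_w(g)`
  have hH : xyWeightedFieldHamiltonian L n w (fun x => (f₁ x : ℝ)) = xyWeightedHamiltonian L n w :=
    xyWeightedFieldHamiltonian_eq_of_badBondCount_eq_zero L n w hN0
  have hEg : Ef g' = (xyWeightedFieldHamiltonian L n w g).groundEnergy := by simp only [hEf, hg']
  have h1 : Ef f₁ = (xyWeightedHamiltonian L n w).groundEnergy := by simp only [hEf, hH]
  rw [← hEg, ← h1, hEf₁]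
  exact hf₀ g'

/-- **Gaussian domination at positive temperature for reflection-invariant nonnegative bond
weights** ([DLS1978] Thm. 4.2 for the couplings of [KLS1988JSP] eq. (5), XY version — the
combination announced on [KLS1988JSP] p. 1020): on the even torus of side `L ≥ 4`, for every
spin, every `β > 0`, every weight `w ≥ 0` with `w(θe) = w(e)` for all reflections through bond
planes, and every real field `h`, `Z_β(H_w(h)) ≤ Z_β(H_w)`. Proof: the descent of [DLS1978],
proof of Thm. 4.2, on maximisers of `Z` with `partitionFn_weighted_sq_le` and
`badBondCount_reflect`. [cite: DysonLiebSimon1978, Thm. 4.2] [cite: KLS1988JSP, p. 1020, eq. (5)] -/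
theorem partitionFn_xyWeightedField_le (hL : Even L) (h4 : 4 ≤ L) {β : ℝ} (hβ : 0 < β)
    {w : Sym2 (TorusSite d L) → ℝ} (hw0 : ∀ e, 0 ≤ w e)
    (hwθ : ∀ (j : Fin d) (a : ZMod L) (e : Sym2 (TorusSite d L)),
      w (e.map (Torus.reflectBetweenSites j a)) = w e)
    (g : TorusSite d L → ℝ) :
    (partitionFn β (xyWeightedFieldHamiltonian L n w g)).re ≤
      (partitionFn β (xyWeightedHamiltonian L n w)).re := by
  classical
  have hL3 : 3 ≤ L := by omega
  have hL2 : 2 ≤ L := by omega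
  -- the finite search space
  set V : Finset ℝ := (univ : Finset (TorusSite d L)).image g with hV
  set Zf : (TorusSite d L → V) → ℝ := fun f =>
    (partitionFn β (xyWeightedFieldHamiltonian L n w (fun x => (f x : ℝ)))).re with hZf
  set Nf : (TorusSite d L → V) → ℕ := fun f => badBondCount L (fun x => (f x : ℝ)) with hNf
  set g' : TorusSite d L → V := fun x => ⟨g x, mem_image_of_mem g (mem_univ x)⟩ with hg'
  haveI : Nonempty (TorusSite d L → V) := ⟨g'⟩
  obtain ⟨f₀, hf₀⟩ := Finite.exists_max Zf
  set S : Finset (TorusSite d L → V) := univ.filter fun f => Zf f = Zf f₀ with hS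
  obtain ⟨f₁, hf₁S, hf₁min⟩ := S.exists_min_image Nf ⟨f₀, by simp [hS]⟩
  have hZf₁ : Zf f₁ = Zf f₀ := (mem_filter.1 hf₁S).2
  have hZpos : ∀ f : TorusSite d L → ℝ, 0 < (partitionFn β (xyWeightedFieldHamiltonian L n w f)).re :=
    fun f => (partitionFn_re_pos β (xyWeightedFieldHamiltonian_isHermitian L n w f)).1
  -- the maximiser has no bad bonds
  have hN0 : Nf f₁ = 0 := by
    by_contra hN
    obtain ⟨x₀, i, hbad⟩ := exists_bad_pair L hN
    set j := i
    obtain ⟨hxCS, hθx⟩ := add_single_mem_torusCrossSites L hL2 j x₀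
    set a : ZMod L := x₀ j with ha
    set φ : TorusSite d L → ℝ := fun x => (f₁ x : ℝ) with hφ
    set fL : TorusSite d L → V := fun y =>
      if y ∈ torusLeftHalf L j a then f₁ y else f₁ (Torus.reflectBetweenSites j a y) with hfL
    set fR : TorusSite d L → V := fun y =>
      if y ∈ torusLeftHalf L j a then f₁ (Torus.reflectBetweenSites j a y) else f₁ y with hfR
    have hfLφ : (fun x => (fL x : ℝ)) = reflectFieldLeft L j a φ := by
      funext y
      simp only [hfL, reflectFieldLeft, hφ]
      split_ifs <;> rfl
    have hfRφ : (fun x => (fR x : ℝ)) = reflectFieldRight L j a φ := by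
      funext y
      simp only [hfR, reflectFieldRight, hφ]
      split_ifs <;> rfl
    have hRP := partitionFn_weighted_sq_le L j a n hL hL3 hβ hw0 (hwθ j a) φ
    have hEL : Zf fL = (partitionFn β (xyWeightedFieldHamiltonian L n w (reflectFieldLeft L j a φ))).re := by
      simp only [hZf, hfLφ]
    have hER : Zf fR = (partitionFn β (xyWeightedFieldHamiltonian L n w (reflectFieldRight L j a φ))).re := by
      simp only [hZf, hfRφ]
    have hE1 : Zf f₁ = (partitionFn β (xyWeightedFieldHamiltonian L n w φ)).re := by simp only [hZf, hφ]
    rw [← hEL, ← hER, ← hE1] at hRP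
    have h1 := hf₀ fL
    have h2 := hf₀ fR
    have hL0 : 0 < Zf fL := by rw [hEL]; exact hZpos _
    have hR0 : 0 < Zf fR := by rw [hER]; exact hZpos _
    have hELm : Zf fL = Zf f₀ := by
      by_contra hne
      have hlt : Zf fL < Zf f₀ := lt_of_le_of_ne h1 hne
      have : Zf fL * Zf fR < Zf f₀ * Zf f₀ := mul_lt_mul hlt h2 hR0 (hlt.le.trans' hL0.le)
      rw [hZf₁] at hRP
      nlinarith
    have hERm : Zf fR = Zf f₀ := by
      by_contra hne
      have hlt : Zf fR < Zf f₀ := lt_of_le_of_ne h2 hne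
      have : Zf fL * Zf fR < Zf f₀ * Zf f₀ := mul_lt_mul' h1 hlt hR0.le (hL0.trans_le h1)
      rw [hZf₁] at hRP
      nlinarith
    have hNL : Nf f₁ ≤ Nf fL := hf₁min fL (by simp [hS, hELm])
    have hNR : Nf f₁ ≤ Nf fR := hf₁min fR (by simp [hS, hERm])
    have hcount := badBondCount_reflect L j a hL φ
    have hNLφ : Nf fL = badBondCount L (reflectFieldLeft L j a φ) := by simp only [hNf, hfLφ]
    have hNRφ : Nf fR = badBondCount L (reflectFieldRight L j a φ) := by simp only [hNf, hfRφ]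
    have hN1φ : Nf f₁ = badBondCount L φ := by simp only [hNf, hφ]
    have hC : 1 ≤ ∑ x ∈ torusCrossSites L j a,
        (if (Sym2.map φ s(x, Torus.reflectBetweenSites j a x)).IsDiag then 0 else 1) := by
      have hone : (if (Sym2.map φ s(x₀ + Pi.single j 1,
          Torus.reflectBetweenSites j a (x₀ + Pi.single j 1))).IsDiag then 0 else 1) = 1 := by
        simp only [hθx, Sym2.map_mk, Sym2.mk_isDiag_iff]
        rw [if_neg]
        exact fun h' => hbad h'.symm
      calc 1 = (if (Sym2.map φ s(x₀ + Pi.single j 1,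
          Torus.reflectBetweenSites j a (x₀ + Pi.single j 1))).IsDiag then 0 else 1) := hone.symm
        _ ≤ _ := Finset.single_le_sum (f := fun x =>
          if (Sym2.map φ s(x, Torus.reflectBetweenSites j a x)).IsDiag then 0 else 1)
          (fun _ _ => Nat.zero_le _) hxCS
    rw [← hNLφ, ← hNRφ, ← hN1φ] at hcount
    omega
  have hH : xyWeightedFieldHamiltonian L n w (fun x => (f₁ x : ℝ)) = xyWeightedHamiltonian L n w :=
    xyWeightedFieldHamiltonian_eq_of_badBondCount_eq_zero L n w hN0
  have hEg : Zf g' = (partitionFn β (xyWeightedFieldHamiltonian L n w g)).re := by simp only [hZf, hg']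
  have h1 : Zf f₁ = (partitionFn β (xyWeightedHamiltonian L n w)).re := by simp only [hZf, hH]
  rw [← hEg, ← h1, hZf₁]
  exact hf₀ g'

end Descent


/-! ### Direction-dependent nearest-neighbour couplings -/

section DirCoupling

variable (L : ℕ)

/-- **Direction-dependent nearest-neighbour couplings as a bond weight**: the bond `{x, x ± eᵢ}`
of the torus carries the coupling `Kᵢ` ([KLS1988JSP] eq. (5): "the coupling constant `J_{xy}`
equals 1 for bonds `{xy}` in one of the first two coordinate directions and equals `r` for bonds
in the third coordinate direction"), here `w{x,y} = Σᵢ Kᵢ·[y = x + eᵢ ∨ x = y + eᵢ]`.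
[cite: KLS1988JSP, eq. (5)] -/
def dirCoupling (K : Fin d → ℝ) : Sym2 (TorusSite d L) → ℝ :=
  Sym2.lift ⟨fun x y => ∑ i, if y = x + Pi.single i 1 ∨ x = y + Pi.single i 1 then K i else 0,
    fun x y => by
      dsimp only
      exact sum_congr rfl fun i _ => if_congr or_comm rfl rfl⟩

/-- Nonnegative couplings give a nonnegative weight. [cite: KLS1988JSP, eq. (5)] -/
theorem dirCoupling_nonneg {K : Fin d → ℝ} (hK : ∀ i, 0 ≤ K i) (e : Sym2 (TorusSite d L)) :
    0 ≤ dirCoupling L K e := by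
  induction e using Sym2.ind with
  | h x y =>
    simp only [dirCoupling, Sym2.lift_mk]
    exact sum_nonneg fun i _ => by split_ifs <;> [exact hK i; exact le_rfl]

/-- The unit vectors of the torus are pairwise distinct (`L ≥ 2`). [folklore] -/
private theorem single_injective_of_two_le (hL2 : 2 ≤ L) {i i' : Fin d}
    (h : (Pi.single i (1 : ZMod L) : TorusSite d L) = Pi.single i' 1) : i = i' := by
  haveI : Fact (1 < L) := ⟨by omega⟩
  by_contra hij
  have := congrFun h i
  rw [Pi.single_eq_same, Pi.single_eq_of_ne hij] at this
  exact one_ne_zero this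

/-- On a torus of side `L ≥ 3` no two unit vectors add up to zero. [folklore] -/
private theorem single_add_single_ne_zero (hL3 : 3 ≤ L) (i i' : Fin d) :
    (Pi.single i (1 : ZMod L) : TorusSite d L) + Pi.single i' 1 ≠ 0 := by
  haveI : Fact (1 < L) := ⟨by omega⟩
  intro h
  have h2 := congrFun h i
  by_cases hij : i' = i
  · subst hij
    rw [Pi.add_apply, Pi.single_eq_same, Pi.zero_apply, show (1 : ZMod L) + 1 = (2 : ℕ) by
      norm_num, ZMod.natCast_eq_zero_iff] at h2
    have := Nat.le_of_dvd two_pos h2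
    omega
  · rw [Pi.add_apply, Pi.single_eq_same, Pi.single_eq_of_ne (Ne.symm hij), Pi.zero_apply,
      add_zero] at h2
    exact one_ne_zero h2

/-- **The weight of the bond `{x, x + eᵢ}` is `Kᵢ`** (side `L ≥ 3`). [cite: KLS1988JSP, eq. (5)] -/
theorem dirCoupling_mk_add_single (hL3 : 3 ≤ L) (K : Fin d → ℝ) (x : TorusSite d L) (i : Fin d) :
    dirCoupling L K s(x, x + Pi.single i 1) = K i := by
  simp only [dirCoupling, Sym2.lift_mk]
  rw [Finset.sum_eq_single i]
  · rw [if_pos (Or.inl rfl)]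
  · intro i' _ hi'
    rw [if_neg]
    rintro (h | h)
    · exact hi' (single_injective_of_two_le L (by omega) (add_left_cancel h)).symm
    · rw [add_assoc] at h
      exact single_add_single_ne_zero L hL3 i i' (left_eq_add.1 h)
  · intro hi
    exact absurd (mem_univ i) hi

/-- The weight of a bond of the torus graph written as `{x, y}` with `y = x + eᵢ`. [cite: KLS1988JSP, eq. (5)] -/
theorem dirCoupling_mk_of_eq_add (hL3 : 3 ≤ L) (K : Fin d → ℝ) {x y : TorusSite d L} {i : Fin d}
    (h : y = x + Pi.single i 1) : dirCoupling L K s(x, y) = K i := by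
  rw [h, dirCoupling_mk_add_single L hL3]

/-- **Reflection invariance**: the reflection through planes perpendicular to direction `j`
maps every bond to a bond of the same direction, so `w(θe) = w(e)` for direction-dependent
couplings (`θ(x + eᵢ) = θx + eᵢ` for `i ≠ j`, `θ(x + eⱼ) = θx - eⱼ`). [cite: KLS1988JSP, p. 1027] -/
theorem dirCoupling_map_reflectBetweenSites (j : Fin d) (a : ZMod L) (K : Fin d → ℝ)
    (e : Sym2 (TorusSite d L)) :
    dirCoupling L K (e.map (Torus.reflectBetweenSites j a)) = dirCoupling L K e := by
  induction e using Sym2.ind with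
  | h x y =>
    simp only [Sym2.map_mk, dirCoupling, Sym2.lift_mk]
    refine sum_congr rfl fun i _ => ?_
    set θ := Torus.reflectBetweenSites j a with hθ
    have hθθ : ∀ z : TorusSite d L, θ (θ z) = z := reflectBetweenSites_reflectBetweenSites L j a
    have hiff : (θ y = θ x + Pi.single i 1 ∨ θ x = θ y + Pi.single i 1) ↔
        (y = x + Pi.single i 1 ∨ x = y + Pi.single i 1) := by
      by_cases hi : i = j
      · subst hi
        have key : ∀ u v : TorusSite d L, v = u + Pi.single i 1 → θ u = θ v + Pi.single i 1 := by
          intro u v h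
          rw [h, hθ, reflectBetweenSites_add_single_self, sub_add_cancel]
        constructor
        · rintro (h | h)
          · right; have := key (θ x) (θ y) h; rwa [hθθ, hθθ] at this
          · left; have := key (θ y) (θ x) h; rwa [hθθ, hθθ] at this
        · rintro (h | h)
          · right; exact key x y h
          · left; exact key y x h
      · have key : ∀ u v : TorusSite d L, v = u + Pi.single i 1 → θ v = θ u + Pi.single i 1 := by
          intro u v h
          rw [h, hθ, reflectBetweenSites_add_single_of_ne L j a u hi]
        constructor
        · rintro (h | h)
          · left; have := key (θ x) (θ y) h; rwa [hθθ, hθθ] at this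
          · right; have := key (θ y) (θ x) h; rwa [hθθ, hθθ] at this
        · rintro (h | h)
          · left; exact key x y h
          · right; exact key y x h
    simp only [hiff]

variable [NeZero L]

/-- A constant coupling `Kᵢ = c` gives the weight `c` on every bond (`L ≥ 3`; the isotropic case
`r = 1` of [KLS1988JSP] eq. (5)). [cite: KLS1988JSP, eq. (5)] -/
theorem dirCoupling_const_of_mem (hL3 : 3 ≤ L) (c : ℝ) {e : Sym2 (TorusSite d L)}
    (he : e ∈ (torusGraph d L).edgeFinset) : dirCoupling L (fun _ : Fin d => c) e = c := by
  revert he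
  induction e using Sym2.ind with
  | h x y =>
    intro he
    rw [SimpleGraph.mem_edgeFinset, SimpleGraph.mem_edgeSet, torusGraph_adj_iff] at he
    obtain ⟨-, ⟨i, hi⟩ | ⟨i, hi⟩⟩ := he
    · exact dirCoupling_mk_of_eq_add L hL3 _ hi
    · rw [Sym2.eq_swap]
      exact dirCoupling_mk_of_eq_add L hL3 _ hi

variable (n : ℕ)

/-- **The quantum XY model with direction-dependent couplings**
`H_K = -Σ_x Σᵢ Kᵢ (S¹_xS¹_{x+eᵢ} + S²_xS²_{x+eᵢ})` on `(ℤ/Lℤ)^d`, spin `n/2` — the XY version of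
[KLS1988JSP] eq. (5) (`K = (1, 1, r)`: "the model that interpolates between two and three
dimensions"); for `S = ½`, hard-core lattice bosons with direction-dependent hopping.
[cite: KLS1988JSP, eq. (5)] [cite: KLS1988PRL, eq. (1)] -/
def xyAnisoTorus (K : Fin d → ℝ) : Op (TorusSite d L) (n + 1) :=
  xyWeightedHamiltonian L n (dirCoupling L K)

/-- The field Hamiltonian of the anisotropic model,
`H_K(h) = Σ_x Σᵢ Kᵢ [-S¹_xS¹_{x+eᵢ} - S²_xS²_{x+eᵢ} - (h_x - h_{x+eᵢ})(S¹_x - S¹_{x+eᵢ}) + ½(h_x - h_{x+eᵢ})²]`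
([KLS1988JSP] eq. (17) for the couplings (5)). [cite: KLS1988JSP, eqs. (5), (17)] -/
def xyAnisoFieldHamiltonian (K : Fin d → ℝ) (h : TorusSite d L → ℝ) : Op (TorusSite d L) (n + 1) :=
  xyWeightedFieldHamiltonian L n (dirCoupling L K) h

/-- The anisotropic gradient coupling `V_K(h) = Σ_x Σᵢ Kᵢ (h_x - h_{x+eᵢ})(S¹_x - S¹_{x+eᵢ})` (the
term linear in `h`; `xyGradField` for `K ≡ 1`). [cite: KLS1988JSP, eq. (17)] -/
def xyAnisoGradField (K : Fin d → ℝ) (h : TorusSite d L → ℝ) : Op (TorusSite d L) (n + 1) :=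
  ∑ x : TorusSite d L, ∑ i : Fin d,
    ((K i * (h x - h (x + Pi.single i 1)) : ℝ) : ℂ) •
      (siteSpin n x 0 - siteSpin n (x + Pi.single i 1) 0)

/-- The anisotropic field energy `Q_K(h) = Σ_x Σᵢ Kᵢ (h_x - h_{x+eᵢ})²` (the anisotropic Dirichlet form
of the torus; `xyFieldEnergy` for `K ≡ 1`). [cite: KLS1988JSP, eq. (17)] -/
def xyAnisoFieldEnergy (K : Fin d → ℝ) (h : TorusSite d L → ℝ) : ℝ :=
  ∑ x : TorusSite d L, ∑ i : Fin d, K i * (h x - h (x + Pi.single i 1)) ^ 2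

/-- **`H_K` as a sum over sites and directions** (`L ≥ 3`):
`H_K = -Σ_x Σᵢ Kᵢ · xyBond(x, x + eᵢ)`. [cite: KLS1988JSP, eq. (5)] -/
theorem xyAnisoTorus_eq_sum (hL3 : 3 ≤ L) (K : Fin d → ℝ) :
    xyAnisoTorus L n K =
      -∑ x : TorusSite d L, ∑ i : Fin d, ((K i : ℝ) : ℂ) • xyBond n x (x + Pi.single i 1) := by
  unfold xyAnisoTorus xyWeightedHamiltonian
  rw [← sum_pairs_eq_sum_edgeFinset' L hL3]
  simp only [Sym2.lift_mk, dirCoupling_mk_add_single L hL3, smul_neg, Finset.sum_neg_distrib]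

/-- **`H_K(h) = H_K - V_K(h) + ½Q_K(h)`** (`L ≥ 3`): the anisotropic field Hamiltonian in the form of
the tree's `xyFieldHamiltonian`. [cite: KLS1988JSP, eq. (17)] -/
theorem xyAnisoFieldHamiltonian_eq (hL3 : 3 ≤ L) (K : Fin d → ℝ) (h : TorusSite d L → ℝ) :
    xyAnisoFieldHamiltonian L n K h =
      xyAnisoTorus L n K - xyAnisoGradField L n K h +
        ((xyAnisoFieldEnergy L K h / 2 : ℝ) : ℂ) • (1 : Op (TorusSite d L) (n + 1)) := by
  unfold xyAnisoFieldHamiltonian xyWeightedFieldHamiltonian xyAnisoGradField xyAnisoFieldEnergy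
  rw [xyAnisoTorus_eq_sum L n hL3, ← sum_pairs_eq_sum_edgeFinset' L hL3]
  simp only [Sym2.lift_mk, dirCoupling_mk_add_single L hL3, xyFieldBond, xyBond]
  rw [sum_div, Complex.ofReal_sum, sum_smul]
  simp_rw [sum_div, Complex.ofReal_sum, sum_smul]
  rw [← Finset.sum_neg_distrib, ← sum_sub_distrib, ← sum_add_distrib]
  refine sum_congr rfl fun x _ => ?_
  rw [← Finset.sum_neg_distrib, ← sum_sub_distrib, ← sum_add_distrib]
  refine sum_congr rfl fun i _ => ?_
  rw [smul_add, smul_sub, smul_sub, smul_smul, smul_smul, ← Complex.ofReal_mul, ← Complex.ofReal_mul,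
    show K i * ((h x - h (x + Pi.single i 1)) ^ 2 / 2) =
      K i * (h x - h (x + Pi.single i 1)) ^ 2 / 2 by ring]
  simp only [smul_neg, smul_add, spinBond]
  abel

/-- `H_K(0) = H_K` ([KLS1988JSP] after eq. (17)). [cite: KLS1988JSP, eq. (17)] -/
theorem xyAnisoFieldHamiltonian_zero (K : Fin d → ℝ) :
    xyAnisoFieldHamiltonian L n K (fun _ => 0) = xyAnisoTorus L n K :=
  xyWeightedFieldHamiltonian_zero L n _

/-- **Consistency with the isotropic model**: `H_{(1,…,1)} = xyTorus d L n` (`L ≥ 3`).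
[cite: KLS1988PRL, eq. (1)] -/
theorem xyAnisoTorus_one (hL3 : 3 ≤ L) :
    xyAnisoTorus L n (fun _ : Fin d => (1 : ℝ)) = xyTorus d L n := by
  unfold xyAnisoTorus xyWeightedHamiltonian
  rw [xyTorus, xyTorus_eq_neg_sum_xyBond, ← Finset.sum_neg_distrib]
  refine sum_congr rfl fun e he => ?_
  rw [dirCoupling_const_of_mem L hL3 1 he, Complex.ofReal_one, one_smul]
  induction e using Sym2.ind with
  | h x y => simp only [Sym2.lift_mk]

/-- **Consistency with the isotropic field Hamiltonian**: `H_{(1,…,1)}(h) = xyFieldHamiltonian L n h`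
(`L ≥ 3`). [cite: KLS1988JSP, eq. (17)] -/
theorem xyAnisoFieldHamiltonian_one (hL3 : 3 ≤ L) (h : TorusSite d L → ℝ) :
    xyAnisoFieldHamiltonian L n (fun _ : Fin d => (1 : ℝ)) h = xyFieldHamiltonian L n h := by
  unfold xyAnisoFieldHamiltonian xyWeightedFieldHamiltonian
  rw [xyFieldHamiltonian_eq_edgeSum L hL3]
  refine sum_congr rfl fun e he => ?_
  rw [dirCoupling_const_of_mem L hL3 1 he, Complex.ofReal_one, one_smul]
  induction e using Sym2.ind with
  | h x y => simp only [Sym2.lift_mk, xyFieldBond]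

/-- `H_K` is Hermitian. [cite: KLS1988JSP, eq. (5)] -/
theorem xyAnisoTorus_isHermitian (K : Fin d → ℝ) : (xyAnisoTorus L n K).IsHermitian :=
  xyWeightedHamiltonian_isHermitian L n _

/-- `H_K(h)` is Hermitian. [cite: KLS1988JSP, eq. (17)] -/
theorem xyAnisoFieldHamiltonian_isHermitian (K : Fin d → ℝ) (h : TorusSite d L → ℝ) :
    (xyAnisoFieldHamiltonian L n K h).IsHermitian :=
  xyWeightedFieldHamiltonian_isHermitian L n _ h

/-- **Ground-state Gaussian domination for direction-dependent couplings** ([KLS1988JSP] eq. (18)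
for the model (5), XY version; "For the model (5) … the bound (14) holds with `E_{q-Q}` replaced
by `E^r_{q-Q}`", p. 1026): on the even torus of side `L ≥ 4`, for every spin, every `K ≥ 0` and
every real field `h`, `E₀(H_K) ≤ E₀(H_K(h))`. [cite: KLS1988JSP, eqs. (5), (18), p. 1026] -/
theorem xyAniso_gaussianDomination_ground (hL : Even L) (h4 : 4 ≤ L) {K : Fin d → ℝ}
    (hK : ∀ i, 0 ≤ K i) (g : TorusSite d L → ℝ) :
    (xyAnisoTorus L n K).groundEnergy ≤ (xyAnisoFieldHamiltonian L n K g).groundEnergy :=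
  xyWeighted_gaussianDomination_ground L n hL h4 (dirCoupling_nonneg L hK)
    (fun j a e => dirCoupling_map_reflectBetweenSites L j a K e) g

/-- **Gaussian domination at positive temperature for direction-dependent couplings**
([DLS1978] Thm. 4.2 for the model of [KLS1988JSP] eq. (5), XY version — the combination
announced on [KLS1988JSP] p. 1020): on the even torus of side `L ≥ 4`, for every spin, every
`β > 0`, every `K ≥ 0` and every real field `h`, `Z_β(H_K(h)) ≤ Z_β(H_K)`.
[cite: DysonLiebSimon1978, Thm. 4.2] [cite: KLS1988JSP, p. 1020, eq. (5)] -/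
theorem partitionFn_xyAnisoField_le (hL : Even L) (h4 : 4 ≤ L) {β : ℝ} (hβ : 0 < β)
    {K : Fin d → ℝ} (hK : ∀ i, 0 ≤ K i) (g : TorusSite d L → ℝ) :
    (partitionFn β (xyAnisoFieldHamiltonian L n K g)).re ≤ (partitionFn β (xyAnisoTorus L n K)).re :=
  partitionFn_xyWeightedField_le L n hL h4 hβ (dirCoupling_nonneg L hK)
    (fun j a e => dirCoupling_map_reflectBetweenSites L j a K e) g

/-- The isotropic special case recovers the tree's ground-state Gaussian domination
`kls_xy_gaussianDomination_ground` (consistency check). [cite: KLS1988JSP, eq. (18)] -/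
theorem xyAniso_gaussianDomination_ground_one (hL : Even L) (h4 : 4 ≤ L) (g : TorusSite d L → ℝ) :
    (xyTorus d L n).groundEnergy ≤ (xyFieldHamiltonian L n g).groundEnergy := by
  have hL3 : 3 ≤ L := by omega
  rw [← xyAnisoTorus_one L n hL3, ← xyAnisoFieldHamiltonian_one L n hL3]
  exact xyAniso_gaussianDomination_ground L n hL h4 (fun _ => zero_le_one) g

end DirCoupling

end Literature.MathematicalPhysics.QuantumLattice
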